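import Literature.NumberTheory.Automorphic.ArchimedeanDetIntegral
import Literature.NumberTheory.Automorphic.GLnArchimedeanFactor
import Literature.NumberTheory.Automorphic.GodementJacquetGlobalHolomorphy
import Literature.NumberTheory.Automorphic.SmallRationalAdeles
import Mathlib.MeasureTheory.Measure.Haar.Unique
import HarnessLib

/-!
# Absolute convergence of the global Godement–Jacquet zeta integral (LNM 260, Thm. 13.8 (1))

Topic `NumberTheory/Automorphic`; namespace `Literature.NumberTheory.Automorphic`. This file proves
the **first clause of the named fact `GodementJacquet1972_gjZeta_meromorphic`**
(`GodementJacquetZetaIntegrals`; Godement–Jacquet, *Zeta functions of simple algebras*, LNM 260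
(1972), §12 and Thm. 13.8: the global zeta integral
`Z(Φ, s, φ, φ') = ∫_{GL_n(𝔸_K)} Φ(x) ⟪φ', R(x) φ⟫ |det x|_𝔸^s dν` converges absolutely for `re s`
large) for the tree's honest objects, unconditionally and for *all* `φ, φ' ∈ L²`:

* `integrable_norm_mul_adelicAbsDet_rpow_of_mem_schwartzBruhat` — **for every Schwartz–Bruhat
  `Φ ∈ 𝒮(M_n(𝔸_K))`, every Haar measure `ν` on `GL_n(𝔸_K)` and every real `σ ≥ n² + n + 2`,
  `x ↦ ‖Φ(x)‖ |det x|_𝔸^σ` is `ν`-integrable.**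
* `GodementJacquet1972_gjZeta_convergence` — hence (with `norm_gjZetaIntegrand_le`,
  `GodementJacquetGlobalHolomorphy`) the Godement–Jacquet integrand is integrable for
  `re s > n² + n + 2`, `Z(Φ, ·, φ, φ')` is holomorphic there, and its truncation
  `Z^{≥1} = ∫_{|det x| ≥ 1}` is entire — clause (1) of the named fact with the explicit abscissa
  `x₀ = n² + n + 2`, and the first half of clause (2).

Proof (LNM 260, §12; Jacquet (1979), §6; Tate for `n = 1`). By linearity it suffices to treat a
factorizable `Φ = Φ_∞ ⊗ Φ_f`. A Schwartz–Bruhat `Φ_f` is bounded and supported in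
`d⁻¹ M_n(𝒪̂_K)` for one non-zero `d ∈ 𝓞 K` (`SmallRationalAdeles`: common denominators on compact
sets), so after the left translation by the rational scalar `(1, d)` (which does not change
Haar measure and multiplies `|det|_𝔸` by a constant) the integrand is dominated by
`1_{M_n(𝒪̂)}(x_f) |Φ_∞(x_∞)| |det x|_𝔸^σ`. Along the tree's decomposition
`GL_n(𝔸_K) = H^∅ · G_∅ = GL_n(𝔸_K^∞) × GL_n(K_∞)` (`awayDecomp`, `awayProductMeasure`,
`GJUnfoldingIntegral`; Haar uniqueness for the comparison with `ν`) this majorant is a product: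
the finite factor `∫_{GL_n(𝔸^∞) ∩ M_n(𝒪̂)} |det h|^σ dh` is finite for `σ ≥ n² + n + 2`
(`integrable_indicator_adelicAbsDet_rpow`, the coset count of `GJUnfoldingCosets`), and the
archimedean factor `∫_{GL_n(K_∞)} |Φ_∞| |det|_∞^σ d^×x` is finite for `σ ≥ n`
(`integrable_schwartz_mul_normDet_rpow` of `ArchimedeanDetIntegral`: `d^×x = |det x|_∞^{-n} dx` and
Schwartz decay; transported along `placesFactorEmptyEquiv` of `GLnArchimedeanFactor`).

Everything here is proved; no definitions, no named facts. The abscissa `n² + n + 2` is the crude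
one of the tree's coset bound (the printed one is `n`); the named fact asks for some abscissa.

## References

* R. Godement, H. Jacquet, *Zeta functions of simple algebras*, LNM 260 (1972), §12, Thm. 13.8
  [GodementJacquet1972].
* H. Jacquet, *Principal `L`-functions of the linear group*, Proc. Sympos. Pure Math. 33 (1979),
  Part 2, §6 [JacquetCorvallis1979].
-/

noncomputable section

open scoped MatrixGroups NNReal ENNReal Classical
open NumberField NumberField.InfinitePlace NumberField.mixedEmbedding IsDedekindDomain MeasureTheory Set
  Filter

namespace Literature.NumberTheory.Automorphic

variable {K : Type} [Field K] [NumberField K] {n : ℕ}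

/-! ### Finite coordinates: multiplicativity, the finite inclusion, integrality -/

section Finite

/-- The finite-coordinate map is multiplicative on `GL_n(𝔸_K)`. [folklore] -/
theorem adelicMatrixFinite_coe_mul (x y : GL (Fin n) (AdeleRing (𝓞 K) K)) :
    adelicMatrixFinite n K ((x * y : GL (Fin n) (AdeleRing (𝓞 K) K)) :
        Matrix (Fin n) (Fin n) (AdeleRing (𝓞 K) K)) =
      adelicMatrixFinite n K (x : Matrix (Fin n) (Fin n) (AdeleRing (𝓞 K) K)) *
        adelicMatrixFinite n K (y : Matrix (Fin n) (Fin n) (AdeleRing (𝓞 K) K)) := by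
  unfold adelicMatrixFinite
  rw [Units.val_mul]
  exact Matrix.map_mul (f := RingHom.snd (InfiniteAdeleRing K) (FiniteAdeleRing (𝓞 K) K))

/-- The finite coordinates of `(1, h) = GLn.ofFinite h` are `h`. [folklore] -/
theorem adelicMatrixFinite_coe_ofFinite (h : GL (Fin n) (FiniteAdeleRing (𝓞 K) K)) :
    adelicMatrixFinite n K ((GLn.ofFinite n K h : GL (Fin n) (AdeleRing (𝓞 K) K)) :
        Matrix (Fin n) (Fin n) (AdeleRing (𝓞 K) K)) = h := by
  have hs := congrArg (fun g : GL (Fin n) (FiniteAdeleRing (𝓞 K) K) =>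
    (g : Matrix (Fin n) (Fin n) (FiniteAdeleRing (𝓞 K) K))) (GLn.sndHom_ofFinite (n := n) (K := K) h)
  exact hs

/-- `(1, h) ∈ H^∅` (its archimedean part is `1`). [folklore] -/
theorem GLn.ofFinite_mem_awayFactor_empty (h : GL (Fin n) (FiniteAdeleRing (𝓞 K) K)) :
    GLn.ofFinite n K h ∈ awayFactor K n ∅ :=
  (mem_range_truncGL_adeleAwayIdem_iff n ∅ _).2 ⟨GLn.fstHom_ofFinite h, fun _ hw => absurd hw
    (Finset.notMem_empty _)⟩

/-- `awayDecomp` on `H^T`: `h ↦ (h, 1)`. [folklore] -/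
theorem awayDecomp_apply_of_mem_awayFactor {T : Finset (HeightOneSpectrum (𝓞 K))}
    {g : GL (Fin n) (AdeleRing (𝓞 K) K)} (hg : g ∈ awayFactor K n T) :
    awayDecomp K n T g = (⟨g, hg⟩, 1) := by
  apply (awayDecomp K n T).symm.injective
  rw [ContinuousMulEquiv.symm_apply_apply, awayDecomp_symm_apply]
  simp

/-- Integrality of `h ∈ H^T` at every place, read on the finite coordinates: `h ∈ Δ^T` iff every
entry of `h_f` is integral at every finite place. [folklore] -/
theorem isIntegralAway_iff_forall_adelicMatrixFinite {T : Finset (HeightOneSpectrum (𝓞 K))}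
    (x : awayFactor K n T) :
    IsIntegralAway x ↔ ∀ (w : HeightOneSpectrum (𝓞 K)) (i j : Fin n),
      (adelicMatrixFinite n K ((x : GL (Fin n) (AdeleRing (𝓞 K) K)) :
        Matrix (Fin n) (Fin n) (AdeleRing (𝓞 K) K)) i j) w ∈ w.adicCompletionIntegers K := by
  refine forall_congr' fun w => forall_congr' fun i => forall_congr' fun j => ?_
  rw [toLocalAway_apply, ← adelicMatrixFinite_coe_apply, mem_integer_adicCompletion_iff,
    HeightOneSpectrum.mem_adicCompletionIntegers]

end Finite

/-! ### A Schwartz–Bruhat function on `M_n(𝔸_K^∞)` is bounded and has a common denominator -/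

section Denominator

/-- **Common denominator and bound for a Schwartz–Bruhat function on `M_n(𝔸_K^∞)`**: there are
`C ≥ 0` and a non-zero `d ∈ 𝓞 K` such that `‖Φ_f‖ ≤ C` everywhere and `d · y` has integral entries
wherever `Φ_f(y) ≠ 0` (a continuous compactly supported function is bounded; the finitely many
entry-images of its support form a compact subset of `𝔸_K^∞`, which has a common denominator,
`FiniteAdeleRing.exists_ne_zero_forall_mem_mul_mem` of `SmallRationalAdeles`). [folklore] -/
theorem exists_bound_denominator_of_mem_schwartzBruhat
    {Φfin : Matrix (Fin n) (Fin n) (FiniteAdeleRing (𝓞 K) K) → ℂ}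
    (hfin : Φfin ∈ SchwartzBruhat (Matrix (Fin n) (Fin n) (FiniteAdeleRing (𝓞 K) K))) :
    ∃ C : ℝ, 0 ≤ C ∧ ∃ d : 𝓞 K, d ≠ 0 ∧ (∀ y, ‖Φfin y‖ ≤ C) ∧
      ∀ y, Φfin y ≠ 0 → ∀ (v : HeightOneSpectrum (𝓞 K)) (i j : Fin n),
        (algebraMap (𝓞 K) (FiniteAdeleRing (𝓞 K) K) d * y i j) v ∈ v.adicCompletionIntegers K := by
  obtain ⟨C, hC⟩ := hfin.2.exists_bound_of_continuous hfin.1.continuous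
  set B : Set (FiniteAdeleRing (𝓞 K) K) :=
    ⋃ i : Fin n, ⋃ j : Fin n, (fun y : Matrix (Fin n) (Fin n) (FiniteAdeleRing (𝓞 K) K) => y i j) ''
      tsupport Φfin with hB
  have hBc : IsCompact B := isCompact_iUnion fun i => isCompact_iUnion fun j =>
    hfin.2.image ((continuous_apply j).comp (continuous_apply i))
  obtain ⟨d, hd, hdB⟩ := FiniteAdeleRing.exists_ne_zero_forall_mem_mul_mem (K := K) hBc
  refine ⟨max C 0, le_max_right _ _, d, hd, fun y => (hC y).trans (le_max_left _ _), ?_⟩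
  intro y hy v i j
  refine hdB (y i j) ?_ v
  rw [hB]
  exact Set.mem_iUnion.2 ⟨i, Set.mem_iUnion.2 ⟨j, y, subset_tsupport _ hy, rfl⟩⟩

end Denominator

/-! ### The archimedean factor of the majorant -/

section Arch

variable [MeasurableSpace (placesFactor K n ∅)] [BorelSpace (placesFactor K n ∅)]

/-- **The archimedean factor is integrable**: for a Haar measure `μG` on `G_∅ ≅ GL_n(K_∞)`, a
Schwartz `Φ_∞` and `σ ≥ n`, `a ↦ ‖Φ_∞(a_∞)‖ |det a|_𝔸^σ` is `μG`-integrable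
(`integrable_schwartz_mul_normDet_rpow` transported along `placesFactorEmptyEquiv`, with
`|det a|_𝔸 = |det a_∞|_∞`, `adelicAbsDet_eq_norm_det_toMixed_of_sndHom_eq_one`).
Godement–Jacquet (1972), §8, §12. [cite: GodementJacquet1972, §12 (proof of Thm. 13.8)] -/
theorem integrable_norm_mul_adelicAbsDet_rpow_placesFactor_empty (μG : Measure (placesFactor K n ∅))
    [μG.IsHaarMeasure] (Φinf : SchwartzMap (Fin n → Fin n → mixedSpace K) ℂ) {σ : ℝ} (hσ : (n : ℝ) ≤ σ) :
    Integrable (fun a : placesFactor K n ∅ =>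
      ‖Φinf (adelicMatrixArch n K ((a : GL (Fin n) (AdeleRing (𝓞 K) K)) :
        Matrix (Fin n) (Fin n) (AdeleRing (𝓞 K) K)))‖ *
        (adelicAbsDet n K (a : GL (Fin n) (AdeleRing (𝓞 K) K)) : ℝ) ^ σ) μG := by
  letI : MeasurableSpace (GL (Fin n) (mixedSpace K)) := borel _
  haveI : BorelSpace (GL (Fin n) (mixedSpace K)) := ⟨rfl⟩
  set e := placesFactorEmptyEquiv K n with he
  have hec : Continuous e := continuous_placesFactorEmptyEquiv K n
  have hesc : Continuous e.symm := continuous_placesFactorEmptyEquiv_symm K n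
  haveI : (Measure.map e μG).IsHaarMeasure := e.isHaarMeasure_map μG hec hesc
  set F : GL (Fin n) (mixedSpace K) → ℝ := fun g =>
    ‖Φinf (Matrix.of.symm (g : Matrix (Fin n) (Fin n) (mixedSpace K)))‖ *
      mixedEmbedding.norm (g : Matrix (Fin n) (Fin n) (mixedSpace K)).det ^ σ with hF
  have hFi : Integrable F (Measure.map e μG) := integrable_schwartz_mul_normDet_rpow _ Φinf hσ
  have hσ0 : 0 ≤ σ := le_trans (Nat.cast_nonneg n) hσ
  have hFc : Continuous F := by
    refine ((Φinf.continuous.comp ?_).norm).mul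
      ((((mixedEmbedding.continuous_norm K).comp (Units.continuous_val.matrix_det))).rpow_const
        fun _ => Or.inr hσ0)
    exact continuous_pi fun i => continuous_pi fun j => Units.continuous_val.matrix_elem i j
  have hcomp := (integrable_map_measure hFc.aestronglyMeasurable hec.aemeasurable).1 hFi
  refine hcomp.congr (Eventually.of_forall fun a => ?_)
  simp only [Function.comp_apply, hF, he, placesFactorEmptyEquiv_apply]
  rw [adelicMatrixArch_coe_eq_of_symm, adelicAbsDet_eq_norm_det_toMixed_of_sndHom_eq_one
    (sndHom_coe_placesFactor_empty K n a)]

end Arch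

/-! ### The factorizable case -/

section Factorizable

variable [MeasurableSpace (GL (Fin n) (AdeleRing (𝓞 K) K))] [BorelSpace (GL (Fin n) (AdeleRing (𝓞 K) K))]

/-- **Absolute convergence for a factorizable test function.** For `Φ = Φ_∞ ⊗ Φ_f`, a Haar
measure `ν` on `GL_n(𝔸_K)` and `σ ≥ n² + n + 2`, `x ↦ ‖Φ(x)‖ |det x|_𝔸^σ` is `ν`-integrable
(Godement–Jacquet (1972), §12, first step of the proof of Thm. 13.8; see the module docstring for
the argument). [cite: GodementJacquet1972, §12 (proof of Thm. 13.8)] -/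
theorem integrable_norm_mul_adelicAbsDet_rpow_of_isFactorizable (ν : Measure (GL (Fin n) (AdeleRing (𝓞 K) K)))
    [ν.IsHaarMeasure] {Φ : Matrix (Fin n) (Fin n) (AdeleRing (𝓞 K) K) → ℂ}
    (hΦ : IsFactorizableSchwartzBruhat n K Φ) {σ : ℝ} (hσ : (n : ℝ) * n + n + 2 ≤ σ) :
    Integrable (fun x : GL (Fin n) (AdeleRing (𝓞 K) K) =>
      ‖Φ x‖ * (adelicAbsDet n K x : ℝ) ^ σ) ν := by
  haveI : LocallyCompactSpace (GL (Fin n) (AdeleRing (𝓞 K) K)) :=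
    AdelicGroupData.locallyCompactSpace_gl_adelic_holds n K
  haveI : SecondCountableTopology (GL (Fin n) (AdeleRing (𝓞 K) K)) :=
    secondCountableTopology_generalLinearGroup_adeleRing K (Fin n)
  have hΦc : Continuous Φ := hΦ.continuous
  obtain ⟨Φinf, Φfin, hfin, rfl⟩ := hΦ
  have hσn : (n : ℝ) ≤ σ := by nlinarith [(Nat.cast_nonneg n : (0 : ℝ) ≤ n)]
  have hσ0 : 0 ≤ σ := le_trans (Nat.cast_nonneg n) hσn
  -- Step 1: bound and common denominator of `Φ_f`, and the rational scalar `δ = (1, d)`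
  obtain ⟨C, hC0, d, hd, hCb, hden⟩ := exists_bound_denominator_of_mem_schwartzBruhat hfin
  have hdK : (algebraMap (𝓞 K) K d) ≠ 0 := fun h => hd ((map_eq_zero_iff _
    (FaithfulSMul.algebraMap_injective (𝓞 K) K)).1 h)
  have hdu : IsUnit (algebraMap (𝓞 K) (FiniteAdeleRing (𝓞 K) K) d) := by
    rw [IsScalarTower.algebraMap_apply (𝓞 K) K (FiniteAdeleRing (𝓞 K) K)]
    exact (isUnit_iff_ne_zero.2 hdK).map _
  set u : (FiniteAdeleRing (𝓞 K) K)ˣ := hdu.unit with hu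
  set δf : GL (Fin n) (FiniteAdeleRing (𝓞 K) K) := Units.map (Matrix.scalar (Fin n)).toMonoidHom u
    with hδf
  set δ : GL (Fin n) (AdeleRing (𝓞 K) K) := GLn.ofFinite n K δf with hδ
  have hδmem : δ ∈ awayFactor K n ∅ := GLn.ofFinite_mem_awayFactor_empty δf
  have hδfin : ∀ x : GL (Fin n) (AdeleRing (𝓞 K) K), ∀ i j,
      adelicMatrixFinite n K ((δ * x : GL (Fin n) (AdeleRing (𝓞 K) K)) :
        Matrix (Fin n) (Fin n) (AdeleRing (𝓞 K) K)) i j =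
      algebraMap (𝓞 K) (FiniteAdeleRing (𝓞 K) K) d *
        adelicMatrixFinite n K (x : Matrix (Fin n) (Fin n) (AdeleRing (𝓞 K) K)) i j := by
    intro x i j
    rw [adelicMatrixFinite_coe_mul, hδ, adelicMatrixFinite_coe_ofFinite, hδf]
    change ((Matrix.scalar (Fin n) (u : FiniteAdeleRing (𝓞 K) K)) *
      adelicMatrixFinite n K (x : Matrix (Fin n) (Fin n) (AdeleRing (𝓞 K) K))) i j = _
    rw [Matrix.scalar_apply, Matrix.diagonal_mul]
    rfl
  set cδ : ℝ := (adelicAbsDet n K δ : ℝ) with hcδ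
  have hcδpos : 0 < cδ := adelicAbsDet_pos δ
  -- Step 2: Haar measures on the factors and comparison with `ν`
  letI : MeasurableSpace (awayFactor K n ∅) := borel _
  haveI : BorelSpace (awayFactor K n ∅) := ⟨rfl⟩
  letI : MeasurableSpace (placesFactor K n ∅) := borel _
  haveI : BorelSpace (placesFactor K n ∅) := ⟨rfl⟩
  haveI := locallyCompactSpace_awayFactor K n (∅ : Finset (HeightOneSpectrum (𝓞 K)))
  haveI := locallyCompactSpace_placesFactor K n (∅ : Finset (HeightOneSpectrum (𝓞 K)))
  haveI := secondCountableTopology_awayFactor K n (∅ : Finset (HeightOneSpectrum (𝓞 K)))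
  haveI := secondCountableTopology_placesFactor K n (∅ : Finset (HeightOneSpectrum (𝓞 K)))
  set μH : Measure (awayFactor K n ∅) := Measure.haar with hμH
  set μG : Measure (placesFactor K n ∅) := Measure.haar with hμG
  set m := awayProductMeasure K n ∅ μH μG with hm
  haveI : m.IsHaarMeasure := isHaarMeasure_awayProductMeasure μH μG
  set c : ℝ≥0 := ν.haarScalarFactor m with hc
  have hν : ν = c • m := Measure.isMulLeftInvariant_eq_smul ν m
  -- Step 3: the product majorant `M(x) = A(x^H) B(x^G)`
  set e := awayDecomp K n (∅ : Finset (HeightOneSpectrum (𝓞 K))) with he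
  set A : awayFactor K n ∅ → ℝ := fun h => {x : awayFactor K n ∅ | IsIntegralAway x}.indicator
    (fun h => (adelicAbsDet n K (h : GL (Fin n) (AdeleRing (𝓞 K) K)) : ℝ) ^ σ) h with hA
  set B : placesFactor K n ∅ → ℝ := fun a =>
    ‖Φinf (adelicMatrixArch n K ((a : GL (Fin n) (AdeleRing (𝓞 K) K)) :
      Matrix (Fin n) (Fin n) (AdeleRing (𝓞 K) K)))‖ *
      (adelicAbsDet n K (a : GL (Fin n) (AdeleRing (𝓞 K) K)) : ℝ) ^ σ with hB
  set M : GL (Fin n) (AdeleRing (𝓞 K) K) → ℝ := fun x => A (e x).1 * B (e x).2 with hM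
  have hAi : Integrable A μH := (integrable_indicator_adelicAbsDet_rpow (T := ∅) μH hσ).1
  have hBi : Integrable B μG := integrable_norm_mul_adelicAbsDet_rpow_placesFactor_empty μG Φinf hσn
  have hAm : Measurable A := by
    refine (Continuous.measurable ?_).indicator isOpen_setOf_isIntegralAway.measurableSet
    exact (continuous_adelicAbsDet.comp continuous_subtype_val).rpow_const fun _ => Or.inr hσ0
  have hBm : Measurable B := by
    refine Continuous.measurable ?_
    refine ((Φinf.continuous.comp (continuous_adelicMatrixArch.comp
      (Units.continuous_val.comp continuous_subtype_val))).norm).mul ?_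
    exact (continuous_adelicAbsDet.comp continuous_subtype_val).rpow_const fun _ => Or.inr hσ0
  have hABm : Measurable fun p : awayFactor K n ∅ × placesFactor K n ∅ => A p.1 * B p.2 :=
    (hAm.comp measurable_fst).mul (hBm.comp measurable_snd)
  have hMm : Measurable M := hABm.comp e.continuous.measurable
  have hMi_m : Integrable M m := by
    rw [hm, awayProductMeasure]
    refine (integrable_map_measure hMm.aestronglyMeasurable
      e.symm.continuous.measurable.aemeasurable).2 ?_
    have hprod : Integrable (fun p : awayFactor K n ∅ × placesFactor K n ∅ => A p.1 * B p.2)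
        (μH.prod μG) := hAi.mul_prod hBi
    refine hprod.congr (Eventually.of_forall fun p => ?_)
    change A p.1 * B p.2 = A (e (e.symm p)).1 * B (e (e.symm p)).2
    rw [ContinuousMulEquiv.apply_symm_apply]
  have hMi : Integrable M ν := by
    rw [hν]
    exact hMi_m.smul_measure ENNReal.coe_ne_top
  -- Step 4: the translated majorant dominates
  have hMδ : Integrable (fun x => M (δ * x)) ν := hMi.comp_mul_left δ
  have hmaj : Integrable (fun x => C * cδ ^ (-σ) * M (δ * x)) ν := hMδ.const_mul _
  refine hmaj.mono' ?_ (Eventually.of_forall fun x => ?_)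
  · exact (((hΦc.comp Units.continuous_val).norm).mul
      (continuous_adelicAbsDet.rpow_const fun _ => Or.inr hσ0)).aestronglyMeasurable
  -- pointwise: write `x = h a` along the decomposition
  rw [Real.norm_of_nonneg (mul_nonneg (norm_nonneg _) (Real.rpow_nonneg (NNReal.coe_nonneg _) _))]
  show ‖Φinf (adelicMatrixArch n K (x : Matrix (Fin n) (Fin n) (AdeleRing (𝓞 K) K))) *
      Φfin (adelicMatrixFinite n K (x : Matrix (Fin n) (Fin n) (AdeleRing (𝓞 K) K)))‖ *
        (adelicAbsDet n K x : ℝ) ^ σ ≤ C * cδ ^ (-σ) * M (δ * x)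
  set h : awayFactor K n ∅ := (e x).1 with hh
  set a : placesFactor K n ∅ := (e x).2 with ha
  have hx : x = (h : GL (Fin n) (AdeleRing (𝓞 K) K)) * (a : GL (Fin n) (AdeleRing (𝓞 K) K)) := by
    rw [hh, ha, ← awayDecomp_symm_apply]
    simp [he]
  have ha1 : GLn.sndHom n K (a : GL (Fin n) (AdeleRing (𝓞 K) K)) = 1 :=
    sndHom_coe_placesFactor_empty K n a
  -- the decomposition of `δ x`
  have heδ : e (δ * x) = (⟨δ, hδmem⟩ * h, a) := by
    rw [map_mul, he, awayDecomp_apply_of_mem_awayFactor hδmem, ← he]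
    exact Prod.ext (by simp [hh]) (by simp [ha])
  -- values of the coordinates along `x = h a`
  have harch : adelicMatrixArch n K (x : Matrix (Fin n) (Fin n) (AdeleRing (𝓞 K) K)) =
      adelicMatrixArch n K ((a : GL (Fin n) (AdeleRing (𝓞 K) K)) :
        Matrix (Fin n) (Fin n) (AdeleRing (𝓞 K) K)) := by
    rw [hx]; exact adelicMatrixArch_awayFactor_mul h _
  have hfinx : adelicMatrixFinite n K (x : Matrix (Fin n) (Fin n) (AdeleRing (𝓞 K) K)) =
      adelicMatrixFinite n K ((h : GL (Fin n) (AdeleRing (𝓞 K) K)) :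
        Matrix (Fin n) (Fin n) (AdeleRing (𝓞 K) K)) := by
    rw [hx, adelicMatrixFinite_coe_mul, adelicMatrixFinite_coe_eq_one_of_sndHom_eq_one ha1, mul_one]
  have hdetx : (adelicAbsDet n K x : ℝ) =
      (adelicAbsDet n K (h : GL (Fin n) (AdeleRing (𝓞 K) K)) : ℝ) *
        (adelicAbsDet n K (a : GL (Fin n) (AdeleRing (𝓞 K) K)) : ℝ) := by
    rw [hx, map_mul, NNReal.coe_mul]
  -- the value of the translated majorant
  have hMval : M (δ * x) = A (⟨δ, hδmem⟩ * h) * B a := by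
    rw [hM]; dsimp only; rw [heδ]
  have hdetδh : (adelicAbsDet n K (((⟨δ, hδmem⟩ * h : awayFactor K n ∅) : GL (Fin n) (AdeleRing (𝓞 K) K))) : ℝ) =
      cδ * (adelicAbsDet n K (h : GL (Fin n) (AdeleRing (𝓞 K) K)) : ℝ) := by
    rw [Subgroup.coe_mul, map_mul, NNReal.coe_mul]
  set DH : ℝ := (adelicAbsDet n K (h : GL (Fin n) (AdeleRing (𝓞 K) K)) : ℝ) with hDH
  set DA : ℝ := (adelicAbsDet n K (a : GL (Fin n) (AdeleRing (𝓞 K) K)) : ℝ) with hDA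
  have hDH0 : 0 ≤ DH := NNReal.coe_nonneg _
  have hDA0 : 0 ≤ DA := NNReal.coe_nonneg _
  have hBval : B a = ‖Φinf (adelicMatrixArch n K ((a : GL (Fin n) (AdeleRing (𝓞 K) K)) :
      Matrix (Fin n) (Fin n) (AdeleRing (𝓞 K) K)))‖ * DA ^ σ := rfl
  have hB0 : 0 ≤ B a := mul_nonneg (norm_nonneg _) (Real.rpow_nonneg hDA0 _)
  -- case split: does `Φ_f(x_f)` vanish?
  by_cases hzero : Φfin (adelicMatrixFinite n K (x : Matrix (Fin n) (Fin n) (AdeleRing (𝓞 K) K))) = 0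
  · have hL : ‖Φinf (adelicMatrixArch n K (x : Matrix (Fin n) (Fin n) (AdeleRing (𝓞 K) K))) *
        Φfin (adelicMatrixFinite n K (x : Matrix (Fin n) (Fin n) (AdeleRing (𝓞 K) K)))‖ *
          (adelicAbsDet n K x : ℝ) ^ σ = 0 := by rw [hzero, mul_zero, norm_zero, zero_mul]
    rw [hL]
    refine mul_nonneg (mul_nonneg hC0 (Real.rpow_nonneg hcδpos.le _)) ?_
    rw [hMval]
    exact mul_nonneg (Set.indicator_nonneg (fun _ _ => Real.rpow_nonneg (NNReal.coe_nonneg _) _) _) hB0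
  · -- `Φ_f(x_f) ≠ 0`: then `δ h` is integral and the indicator is `1`
    have hint : IsIntegralAway (⟨δ, hδmem⟩ * h : awayFactor K n ∅) := by
      rw [isIntegralAway_iff_forall_adelicMatrixFinite]
      intro w i j
      have hcoe : (((⟨δ, hδmem⟩ * h : awayFactor K n ∅) : GL (Fin n) (AdeleRing (𝓞 K) K)) :
          Matrix (Fin n) (Fin n) (AdeleRing (𝓞 K) K)) =
        Units.val (δ * (h : GL (Fin n) (AdeleRing (𝓞 K) K))) := rfl
      rw [hcoe, hδfin, ← hfinx]
      exact hden _ hzero w i j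
    have hAval : A (⟨δ, hδmem⟩ * h) = (cδ * DH) ^ σ := by
      rw [hA]; dsimp only
      rw [Set.indicator_of_mem (show (⟨δ, hδmem⟩ * h : awayFactor K n ∅) ∈
        {x : awayFactor K n ∅ | IsIntegralAway x} from hint), hdetδh]
    have hΦf := hCb (adelicMatrixFinite n K (x : Matrix (Fin n) (Fin n) (AdeleRing (𝓞 K) K)))
    set P : ℝ := ‖Φinf (adelicMatrixArch n K ((a : GL (Fin n) (AdeleRing (𝓞 K) K)) :
      Matrix (Fin n) (Fin n) (AdeleRing (𝓞 K) K)))‖ with hP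
    have hP0 : 0 ≤ P := norm_nonneg _
    have hcσ : 0 < cδ ^ σ := Real.rpow_pos_of_pos hcδpos σ
    have hlhs : ‖Φinf (adelicMatrixArch n K (x : Matrix (Fin n) (Fin n) (AdeleRing (𝓞 K) K))) *
        Φfin (adelicMatrixFinite n K (x : Matrix (Fin n) (Fin n) (AdeleRing (𝓞 K) K)))‖ *
          (adelicAbsDet n K x : ℝ) ^ σ =
        P * ‖Φfin (adelicMatrixFinite n K (x : Matrix (Fin n) (Fin n) (AdeleRing (𝓞 K) K)))‖ *
          (DH ^ σ * DA ^ σ) := by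
      rw [norm_mul, harch, hdetx, Real.mul_rpow hDH0 hDA0]
    have hrhs : C * cδ ^ (-σ) * M (δ * x) = C * (cδ ^ σ)⁻¹ * (cδ ^ σ * DH ^ σ * (P * DA ^ σ)) := by
      rw [hMval, hAval, hBval, Real.mul_rpow hcδpos.le hDH0, Real.rpow_neg hcδpos.le]
    rw [hlhs, hrhs]
    calc P * ‖Φfin (adelicMatrixFinite n K (x : Matrix (Fin n) (Fin n) (AdeleRing (𝓞 K) K)))‖ *
          (DH ^ σ * DA ^ σ)
        ≤ P * C * (DH ^ σ * DA ^ σ) :=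
          mul_le_mul_of_nonneg_right (mul_le_mul_of_nonneg_left hΦf hP0)
            (mul_nonneg (Real.rpow_nonneg hDH0 _) (Real.rpow_nonneg hDA0 _))
      _ = C * ((cδ ^ σ)⁻¹ * cδ ^ σ) * (DH ^ σ * (P * DA ^ σ)) := by
          rw [inv_mul_cancel₀ hcσ.ne', mul_one]; ring
      _ = C * (cδ ^ σ)⁻¹ * (cδ ^ σ * DH ^ σ * (P * DA ^ σ)) := by ring

end Factorizable

/-! ### The general case and clause (1) of the named fact -/

section General

variable [MeasurableSpace (GL (Fin n) (AdeleRing (𝓞 K) K))] [BorelSpace (GL (Fin n) (AdeleRing (𝓞 K) K))]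

/-- **Absolute convergence of `∫ |Φ(x)| |det x|_𝔸^σ dν` for every Schwartz–Bruhat `Φ`** on
`M_n(𝔸_K)`, every Haar measure `ν` on `GL_n(𝔸_K)` and every `σ ≥ n² + n + 2` (linearity over the
factorizable case `integrable_norm_mul_adelicAbsDet_rpow_of_isFactorizable`). Godement–Jacquet
(1972), §12: "the integral `∫ Φ(x) |det x|^s d^×x` converges absolutely for `re s` large".
[cite: GodementJacquet1972, §12 (proof of Thm. 13.8)] -/
theorem integrable_norm_mul_adelicAbsDet_rpow_of_mem_schwartzBruhat
    (ν : Measure (GL (Fin n) (AdeleRing (𝓞 K) K))) [ν.IsHaarMeasure]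
    {Φ : Matrix (Fin n) (Fin n) (AdeleRing (𝓞 K) K) → ℂ} (hΦ : Φ ∈ schwartzBruhatAdelicMatrix n K)
    {σ : ℝ} (hσ : (n : ℝ) * n + n + 2 ≤ σ) :
    Integrable (fun x : GL (Fin n) (AdeleRing (𝓞 K) K) => ‖Φ x‖ * (adelicAbsDet n K x : ℝ) ^ σ) ν := by
  have hσ0 : 0 ≤ σ := by nlinarith [(Nat.cast_nonneg n : (0 : ℝ) ≤ n)]
  have hmeas : ∀ {Ψ : Matrix (Fin n) (Fin n) (AdeleRing (𝓞 K) K) → ℂ},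
      Ψ ∈ schwartzBruhatAdelicMatrix n K →
        AEStronglyMeasurable (fun x : GL (Fin n) (AdeleRing (𝓞 K) K) =>
          ‖Ψ x‖ * (adelicAbsDet n K x : ℝ) ^ σ) ν := fun hΨ =>
    ((((continuous_of_mem_schwartzBruhatAdelicMatrix hΨ).comp Units.continuous_val).norm).mul
      (continuous_adelicAbsDet.rpow_const fun _ => Or.inr hσ0)).aestronglyMeasurable
  induction hΦ using Submodule.span_induction with
  | mem Ψ hΨ => exact integrable_norm_mul_adelicAbsDet_rpow_of_isFactorizable ν hΨ hσ
  | zero => simp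
  | add Ψ₁ Ψ₂ h₁m h₂m h₁ h₂ =>
      refine (h₁.add h₂).mono' (hmeas (Submodule.add_mem _ h₁m h₂m)) (Eventually.of_forall fun x => ?_)
      rw [Real.norm_of_nonneg (mul_nonneg (norm_nonneg _) (Real.rpow_nonneg (NNReal.coe_nonneg _) _)),
        Pi.add_apply, Pi.add_apply, ← add_mul]
      exact mul_le_mul_of_nonneg_right (norm_add_le _ _) (Real.rpow_nonneg (NNReal.coe_nonneg _) _)
  | smul c Ψ hΨm h =>
      refine (h.const_mul ‖c‖).congr (Eventually.of_forall fun x => ?_)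
      simp only [Pi.smul_apply, smul_eq_mul, norm_mul]
      ring

variable {μ : Measure (AdelicGroupData.gl n K).automorphicQuotient}
  [(AdelicGroupData.gl n K).IsAutomorphicMeasure μ]

/-- **Clause (1) of `GodementJacquet1972_gjZeta_meromorphic`, with holomorphy, unconditionally.**
For every Schwartz–Bruhat `Φ` on `M_n(𝔸_K)`, all `φ, φ' ∈ L²(GL_n(𝔸_K) ⧸ A_G GL_n(K))` (no
cuspidality or `K`-finiteness is needed for this clause) and every Haar measure `ν` on
`GL_n(𝔸_K)`: the Godement–Jacquet integrand is `ν`-integrable for `re s > n² + n + 2`, the zeta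
integral `Z(Φ, ·, φ, φ')` is holomorphic on that half-plane, and its truncation
`Z^{≥1}(Φ, ·) = gjZeta μ (ν.restrict (detAtLeastOne n K)) Φ φ φ'` is an entire function
(Godement–Jacquet (1972), §12 and Thm. 13.8 (1); the entireness of `Z^{≥1}` is the first step of
the continuation, §13). [cite: GodementJacquet1972, Thm. 13.8 (1) and §12] -/
theorem GodementJacquet1972_gjZeta_convergence (ν : Measure (GL (Fin n) (AdeleRing (𝓞 K) K)))
    [ν.IsHaarMeasure] {Φ : Matrix (Fin n) (Fin n) (AdeleRing (𝓞 K) K) → ℂ}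
    (hΦ : Φ ∈ schwartzBruhatAdelicMatrix n K) (φ φ' : (AdelicGroupData.gl n K).L2 μ) :
    (∀ s : ℂ, (n : ℝ) * n + n + 2 < s.re → Integrable (gjZetaIntegrand μ Φ φ φ' s) ν) ∧
      DifferentiableOn ℂ (gjZeta μ ν Φ φ φ') {s : ℂ | (n : ℝ) * n + n + 2 < s.re} ∧
        Differentiable ℂ (gjZeta μ (ν.restrict (detAtLeastOne n K)) Φ φ φ') := by
  have hc : Continuous fun x : GL (Fin n) (AdeleRing (𝓞 K) K) =>
      Φ (x : Matrix (Fin n) (Fin n) (AdeleRing (𝓞 K) K)) :=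
    (continuous_of_mem_schwartzBruhatAdelicMatrix hΦ).comp Units.continuous_val
  have h : ∀ σ : ℝ, (n : ℝ) * n + n + 2 < σ →
      Integrable (fun x : GL (Fin n) (AdeleRing (𝓞 K) K) => ‖Φ x‖ * (adelicAbsDet n K x : ℝ) ^ σ) ν :=
    fun σ hσ => integrable_norm_mul_adelicAbsDet_rpow_of_mem_schwartzBruhat ν hΦ hσ.le
  obtain ⟨h1, h2⟩ := integrable_and_differentiableOn_gjZeta hc φ φ' h
  exact ⟨h1, h2, differentiable_gjZeta_restrict_detAtLeastOne hc φ φ' h⟩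

end General

end Literature.NumberTheory.Automorphic
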